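import Mathlib
import HarnessLib
import Summits.ABC.ABC.Theorems.SoloBlindTwoadicCore
import Summits.ABC.ABC.Theorems.SoloBlindOmega3Prelude

/-!
# `ω = 3`, shape A (`2^k + p^l = q^m`): the KNOWN side, typed — two regimes glued at `p^l = 4^k`

`Summits/ABC/ABC/Theorems/SoloBlindShapeAKnown.lean`; namespace `Summit.ABC.ABC.Theorems`
(solo seat `solo-ABC-blind`, wall coordinate C1⁗(1); uses `SoloBlindTwoadicCore` and `SoloBlindOmega3Prelude`).

Shape A is the one shape of the `{2, p, q}` atlas in which the power of `2` is neither `c` nor `c − 1` and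
`a ≠ 1`: no single completion sees a small linear form on all of it.

* `p^l ≤ 4^k` (`shapeA_near_exponent_le`): `k = ord₂(q^m − p^l) = ord₂(p^{−l} q^m − 1)` and
  `p^l, q^m ≤ 2 · 4^k`, so the `2`-adic core gives `k ≤ 50000 · log p · log q` and `log c ≤ (2k + 1) log 2`;
* `p^l > 4^k` (`shapeA_far_exponent_le`): `Λ = m log q − l log p = log (1 + 2^k/p^l) ∈ (0, p^{−l/2})`, and
  Matveev for two logarithms (`matveev_two_nat`, `B = l + 1`) gives `l < 2³³ · log q · (1 + log (l + 1))`,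
  inverted (`le_of_lt_mul_log_succ_gen`) to `l ≤ 10¹² · log q · (1 + log log q)`; `log c < log 2 + l log p`.
* `shapeA_log_c_le` : `2^k + p^l = q^m` (`k, l, m ≥ 1`) ⟹ `log c ≤ 10¹² · log p · log q · (1 + log log q) + log 2`.

READING.  `abc` on shape A asks for the SUM of the two odd heights; the two named estimates give their
PRODUCT (times one `log log`, the price of the archimedean `log B`).  Trust base: `bugeaudLaurent1996_rat`
and `matveev2000_linearFormsLog_rat`, as hypotheses; everything else is proved.
-/

noncomputable section

namespace Summit.ABC.ABC.Theorems

open Real Height Literature.NumberTheory.Transcendental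
  Literature.NumberTheory.DiophantineGeometry.Dioph

/-- **Shape A, the `2`-adic regime.**  `2^k + p^l = q^m` with `p ≠ q` odd primes, `k, l, m ≥ 1`
and `p^l ≤ 4^k` (as `l log p ≤ 2k log 2`): then `k ≤ 50000 · log p · log q`, by the `2`-adic core
`twoadic_exponent_le` (`ord₂(p^{−l} q^m − 1) = k`, `q^m ≤ 2 · 4^k`). [folklore] -/
theorem shapeA_near_exponent_le (hBL : bugeaudLaurent1996_rat) {p q k l m : ℕ}
    (hp : p.Prime) (hq : q.Prime) (hp2 : p ≠ 2) (hq2 : q ≠ 2) (hpq : p ≠ q)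
    (hk : 0 < k) (hl : 0 < l) (hm : 0 < m) (h : 2 ^ k + p ^ l = q ^ m)
    (hR : (l : ℝ) * Real.log p ≤ 2 * k * Real.log 2) :
    (k : ℝ) ≤ 50000 * Real.log p * Real.log q := by
  have hp3 : 3 ≤ p := by have := hp.two_le; omega
  have hq3 : 3 ≤ q := by have := hq.two_le; omega
  have hlog2 : 0 < Real.log 2 := Real.log_pos (by norm_num)
  have hk1 : (1 : ℝ) ≤ k := by exact_mod_cast hk
  have hpR : (0 : ℝ) < p := by exact_mod_cast hp.pos
  have hqR : (0 : ℝ) < q := by exact_mod_cast hq.pos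
  have hqm : ((q : ℝ) ^ m) = 2 ^ k + (p : ℝ) ^ l := by exact_mod_cast h.symm
  -- p^l ≤ 4^k as reals
  have hpl4 : (p : ℝ) ^ l ≤ (4 : ℝ) ^ k := by
    rw [← Real.log_le_log_iff (by positivity) (by positivity), Real.log_pow, Real.log_pow,
      show (4 : ℝ) = 2 ^ 2 by norm_num, Real.log_pow]
    push_cast
    linarith
  have h24 : (2 : ℝ) ^ k ≤ (4 : ℝ) ^ k := pow_le_pow_left₀ (by norm_num) (by norm_num) k
  have hqm_le : (q : ℝ) ^ m ≤ 2 * (4 : ℝ) ^ k := by rw [hqm]; linarith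
  have hs₂' : (m : ℝ) * Real.log q ≤ 3 * k * Real.log 2 := by
    have h1 := Real.log_le_log (by positivity) hqm_le
    rw [Real.log_pow, Real.log_mul (by norm_num) (by positivity), show (4 : ℝ) = 2 ^ 2 by norm_num,
      ← pow_mul, Real.log_pow] at h1
    push_cast at h1
    nlinarith
  have hs₁ : |((-(l : ℤ) : ℤ) : ℝ)| * Real.log p ≤ 3 * k * Real.log 2 := by
    push_cast
    rw [abs_neg, Nat.abs_cast]
    nlinarith
  have hs₂ : |((m : ℤ) : ℝ)| * Real.log q ≤ 3 * k * Real.log 2 := by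
    push_cast
    rw [Nat.abs_cast]
    exact hs₂'
  -- the valuation: ord₂(p^{-l} q^m − 1) = k
  haveI : Fact (Nat.Prime 2) := ⟨Nat.prime_two⟩
  have hp0Q : (p : ℚ) ≠ 0 := by exact_mod_cast hp.ne_zero
  have hvp : padicValRat 2 (p : ℚ) = 0 := by
    rw [padicValRat.of_nat]
    haveI := Fact.mk hp
    exact_mod_cast padicValNat_primes (p := 2) (q := p) (Ne.symm hp2)
  have hLHS : padicValRat 2 (((p : ℤ) : ℚ) ^ (-(l : ℤ)) * ((q : ℤ) : ℚ) ^ (m : ℤ) - 1) = k := by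
    push_cast
    rw [zpow_neg, zpow_natCast, zpow_natCast]
    have hcast : ((p : ℚ) ^ l)⁻¹ * (q : ℚ) ^ m - 1 = (2 : ℚ) ^ k / (p : ℚ) ^ l := by
      have hQ : (2 : ℚ) ^ k + (p : ℚ) ^ l = (q : ℚ) ^ m := by exact_mod_cast h
      rw [← hQ]
      field_simp
      ring
    rw [hcast, padicValRat.div (by positivity) (by positivity), padicValRat.pow, padicValRat.pow,
      hvp]
    have h2 : padicValRat 2 (2 : ℚ) = 1 := by
      have := padicValRat.self (p := 2) (by norm_num)
      exact_mod_cast this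
    rw [h2]; ring
  have hv : (k : ℝ) ≤ padicValRat 2 (((p : ℤ) : ℚ) ^ (-(l : ℤ)) * ((q : ℤ) : ℚ) ^ (m : ℤ) - 1) := by
    rw [hLHS]; push_cast; exact le_rfl
  exact twoadic_exponent_le hBL hp hq hp2 hq2 hpq (Or.inl rfl) (Or.inl rfl)
    (by simpa using hl.ne') (by exact_mod_cast hm.ne') hk hv hs₁ hs₂

/-- **Shape A, the archimedean regime.**  `2^k + p^l = q^m` with `p ≠ q` odd primes, `l, m ≥ 1` and
`p^l > 4^k` (as `2k log 2 < l log p`): then `Λ = m log q − l log p = log(1 + 2^k/p^l)` satisfies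
`0 < Λ < 2^k/p^l < p^{−l/2}`, and Matveev's bound (named fact `matveev2000_linearFormsLog_rat`,
two logarithms, `B = l + 1`) gives `l < 2³³ log q (1 + log (l + 1))`, whence
`l ≤ 10¹² · log q · (1 + log log q)`. [folklore] -/
theorem shapeA_far_exponent_le (hM : matveev2000_linearFormsLog_rat) {p q k l m : ℕ}
    (hp : p.Prime) (hq : q.Prime) (hp2 : p ≠ 2) (hq2 : q ≠ 2)
    (hl : 0 < l) (hm : 0 < m) (h : 2 ^ k + p ^ l = q ^ m)
    (hR : 2 * (k : ℝ) * Real.log 2 < l * Real.log p) :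
    (l : ℝ) ≤ 10 ^ 12 * Real.log q * (1 + Real.log (Real.log q)) := by
  have hp3 : 3 ≤ p := by have := hp.two_le; omega
  have hq3 : 3 ≤ q := by have := hq.two_le; omega
  have hlog2 : 0 < Real.log 2 := Real.log_pos (by norm_num)
  have hl1 : (1 : ℝ) ≤ l := by exact_mod_cast hl
  have hpR : (0 : ℝ) < p := by exact_mod_cast hp.pos
  have hqR : (0 : ℝ) < q := by exact_mod_cast hq.pos
  have hP : 1 < Real.log p := by
    have : Real.log (Real.exp 1) < Real.log p := by
      apply Real.log_lt_log (Real.exp_pos 1)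
      have he : Real.exp 1 < 2.7182818286 := Real.exp_one_lt_d9
      have : (3 : ℝ) ≤ p := by exact_mod_cast hp3
      linarith
    rwa [Real.log_exp] at this
  have hQ : 1 < Real.log q := by
    have : Real.log (Real.exp 1) < Real.log q := by
      apply Real.log_lt_log (Real.exp_pos 1)
      have he : Real.exp 1 < 2.7182818286 := Real.exp_one_lt_d9
      have : (3 : ℝ) ≤ q := by exact_mod_cast hq3
      linarith
    rwa [Real.log_exp] at this
  have hP0 : 0 < Real.log p := by linarith
  have hQ0 : 0 < Real.log q := by linarith
  have hqm : ((q : ℝ) ^ m) = 2 ^ k + (p : ℝ) ^ l := by exact_mod_cast h.symm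
  -- t = 2^k / p^l, 0 < t, 2^k < p^l
  set t : ℝ := (2 : ℝ) ^ k / (p : ℝ) ^ l with ht
  have ht0 : 0 < t := by positivity
  have h2p : (2 : ℝ) ^ k < (p : ℝ) ^ l := by
    rw [← Real.log_lt_log_iff (by positivity) (by positivity), Real.log_pow, Real.log_pow]
    have : (k : ℝ) * Real.log 2 ≤ 2 * k * Real.log 2 := by
      have : (0 : ℝ) ≤ k := Nat.cast_nonneg k
      nlinarith
    linarith
  have hlogt : Real.log t = k * Real.log 2 - l * Real.log p := by
    rw [ht, Real.log_div (by positivity) (by positivity), Real.log_pow, Real.log_pow]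
  -- Λ = log(q^m) - log(p^l) = log (1 + t)
  have hΛeq : -(l : ℝ) * Real.log p + m * Real.log q = Real.log (1 + t) := by
    have e1 : Real.log ((q : ℝ) ^ m) - Real.log ((p : ℝ) ^ l) = Real.log ((q : ℝ) ^ m / (p : ℝ) ^ l) :=
      (Real.log_div (by positivity) (by positivity)).symm
    have e2 : (q : ℝ) ^ m / (p : ℝ) ^ l = 1 + t := by
      rw [hqm, ht]; field_simp; ring
    rw [Real.log_pow, Real.log_pow, e2] at e1
    linarith
  have hΛpos : 0 < Real.log (1 + t) := Real.log_pos (by linarith)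
  have hΛle : Real.log (1 + t) ≤ t := by
    have := Real.log_le_sub_one_of_pos (by linarith : 0 < 1 + t); linarith
  have hlogΛ : Real.log (Real.log (1 + t)) ≤ k * Real.log 2 - l * Real.log p := by
    rw [← hlogt]; exact Real.log_le_log hΛpos hΛle
  -- Matveev with B = l + 1
  have hmq : (m : ℝ) * Real.log q < Real.log 2 + l * Real.log p := by
    have h1 : (q : ℝ) ^ m < 2 * (p : ℝ) ^ l := by rw [hqm]; linarith
    have h2 := Real.log_lt_log (by positivity) h1
    rw [Real.log_pow, Real.log_mul (by norm_num) (by positivity), Real.log_pow] at h2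
    exact h2
  have hlog2p : Real.log 2 ≤ Real.log p :=
    Real.log_le_log (by norm_num) (by exact_mod_cast hp.two_le)
  have key := matveev_two_nat hM hp.two_le hq.two_le (b₁ := -(l : ℤ)) (b₂ := (m : ℤ))
    (by exact_mod_cast hm.ne')
    (by push_cast; rw [hΛeq]; exact hΛpos.ne')
    (B := (l : ℝ) + 1) (by linarith)
    (by push_cast; rw [abs_neg, Nat.abs_cast]; linarith)
    (by push_cast; rw [Nat.abs_cast]; nlinarith)
  push_cast at key
  rw [hΛeq, abs_of_pos hΛpos] at key
  -- combine: l log p / 2 < 2^32 log p log q (1 + log (l+1))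
  have hmain : (l : ℝ) * Real.log p < 2 ^ 33 * (Real.log p * Real.log q) * (1 + Real.log ((l : ℝ) + 1)) := by
    nlinarith
  have hmain' : (l : ℝ) < 2 ^ 33 * Real.log q * (1 + Real.log ((l : ℝ) + 1)) := by
    have := lt_of_mul_lt_mul_right (a := Real.log p)
      (by nlinarith : (l : ℝ) * Real.log p <
        2 ^ 33 * Real.log q * (1 + Real.log ((l : ℝ) + 1)) * Real.log p) hP0.le
    exact this
  exact le_of_lt_mul_log_succ hl1 hQ.le hmain'

/-- **Shape A, known side.**  If `p ≠ q` are odd primes, `k, l, m ≥ 1` and `2^k + p^l = q^m`, then —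
granting the Bugeaud–Laurent `2`-adic two-logarithm estimate and Matveev's archimedean estimate
(named facts `bugeaudLaurent1996_rat`, `matveev2000_linearFormsLog_rat`) —
`log c = log q^m ≤ 10¹² · log p · log q · (1 + log log q) + log 2`:
polynomial in the two heights `log p, log q` (degree one in each, one `log log`), uniformly in the
exponents; `abc` asks for their SUM. [folklore] -/
theorem shapeA_log_c_le (hBL : bugeaudLaurent1996_rat) (hM : matveev2000_linearFormsLog_rat)
    {p q k l m : ℕ} (hp : p.Prime) (hq : q.Prime) (hp2 : p ≠ 2) (hq2 : q ≠ 2) (hpq : p ≠ q)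
    (hk : 0 < k) (hl : 0 < l) (hm : 0 < m) (h : 2 ^ k + p ^ l = q ^ m) :
    Real.log ((q : ℝ) ^ m) ≤
      10 ^ 12 * Real.log p * Real.log q * (1 + Real.log (Real.log q)) + Real.log 2 := by
  have hp3 : 3 ≤ p := by have := hp.two_le; omega
  have hq3 : 3 ≤ q := by have := hq.two_le; omega
  have hlog2 : 0 < Real.log 2 := Real.log_pos (by norm_num)
  have hlog2' : Real.log 2 < 0.6931471808 := Real.log_two_lt_d9
  have hpR : (0 : ℝ) < p := by exact_mod_cast hp.pos
  have hqR : (0 : ℝ) < q := by exact_mod_cast hq.pos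
  have hP : 1 < Real.log p := by
    have : Real.log (Real.exp 1) < Real.log p := by
      apply Real.log_lt_log (Real.exp_pos 1)
      have he : Real.exp 1 < 2.7182818286 := Real.exp_one_lt_d9
      have : (3 : ℝ) ≤ p := by exact_mod_cast hp3
      linarith
    rwa [Real.log_exp] at this
  have hQ : 1 < Real.log q := by
    have : Real.log (Real.exp 1) < Real.log q := by
      apply Real.log_lt_log (Real.exp_pos 1)
      have he : Real.exp 1 < 2.7182818286 := Real.exp_one_lt_d9
      have : (3 : ℝ) ≤ q := by exact_mod_cast hq3
      linarith
    rwa [Real.log_exp] at this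
  have hP0 : 0 < Real.log p := by linarith
  have hQ0 : 0 < Real.log q := by linarith
  have hPQ : 0 < Real.log p * Real.log q := mul_pos hP0 hQ0
  have hll : 0 < Real.log (Real.log q) := Real.log_pos hQ
  have hqm : ((q : ℝ) ^ m) = 2 ^ k + (p : ℝ) ^ l := by exact_mod_cast h.symm
  rcases le_or_gt ((l : ℝ) * Real.log p) (2 * k * Real.log 2) with hR | hR
  · -- 2-adic regime: log c ≤ (2k+1) log 2, k ≤ 50000 log p log q
    have hk50000 := shapeA_near_exponent_le hBL hp hq hp2 hq2 hpq hk hl hm h hR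
    have hpl4 : (p : ℝ) ^ l ≤ (4 : ℝ) ^ k := by
      rw [← Real.log_le_log_iff (by positivity) (by positivity), Real.log_pow, Real.log_pow,
        show (4 : ℝ) = 2 ^ 2 by norm_num, Real.log_pow]
      push_cast
      linarith
    have h24 : (2 : ℝ) ^ k ≤ (4 : ℝ) ^ k := pow_le_pow_left₀ (by norm_num) (by norm_num) k
    have hqm_le : (q : ℝ) ^ m ≤ 2 * (4 : ℝ) ^ k := by rw [hqm]; linarith
    have h1 := Real.log_le_log (by positivity) hqm_le
    rw [Real.log_mul (by norm_num) (by positivity), show (4 : ℝ) = 2 ^ 2 by norm_num,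
      ← pow_mul, Real.log_pow 2 (2 * k)] at h1
    push_cast at h1
    -- log q^m ≤ log 2 + 2 k log 2 ≤ log 2 + 10^5 log 2 · log p log q
    have h2 : (2 : ℝ) * k * Real.log 2 ≤ 10 ^ 12 * Real.log p * Real.log q * 1 := by nlinarith
    have h3 : 10 ^ 12 * Real.log p * Real.log q * 1 ≤
        10 ^ 12 * Real.log p * Real.log q * (1 + Real.log (Real.log q)) := by
      apply mul_le_mul_of_nonneg_left _ (by positivity); linarith
    linarith
  · -- archimedean regime
    have hl12 := shapeA_far_exponent_le hM hp hq hp2 hq2 hl hm h hR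
    have h2p : (2 : ℝ) ^ k < (p : ℝ) ^ l := by
      rw [← Real.log_lt_log_iff (by positivity) (by positivity), Real.log_pow, Real.log_pow]
      have : (k : ℝ) * Real.log 2 ≤ 2 * k * Real.log 2 := by
        have : (0 : ℝ) ≤ k := Nat.cast_nonneg k
        nlinarith
      linarith
    have hmq : Real.log ((q : ℝ) ^ m) < Real.log 2 + l * Real.log p := by
      have h1 : (q : ℝ) ^ m < 2 * (p : ℝ) ^ l := by rw [hqm]; linarith
      have h2 := Real.log_lt_log (by positivity) h1
      rw [Real.log_mul (by norm_num) (by positivity), Real.log_pow (p : ℝ) l] at h2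
      exact h2
    have h3 : (l : ℝ) * Real.log p ≤
        10 ^ 12 * Real.log p * Real.log q * (1 + Real.log (Real.log q)) := by
      have := mul_le_mul_of_nonneg_right hl12 hP0.le
      nlinarith
    linarith

end Summit.ABC.ABC.Theorems

end
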